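import Mathlib.Analysis.InnerProductSpace.Positive
import Mathlib.Analysis.InnerProductSpace.Projection.Submodule
import Mathlib.Analysis.InnerProductSpace.Adjoint
import Mathlib.Analysis.InnerProductSpace.Calculus
import Mathlib.Analysis.Normed.Algebra.Exponential
import Mathlib.Analysis.SpecialFunctions.Exponential
import Mathlib.Analysis.SpecialFunctions.ExpDeriv
import Mathlib.Analysis.Calculus.Deriv.Basic
import Mathlib.Analysis.Calculus.Deriv.MeanValue
import Mathlib.Analysis.ODE.Gronwall

/-!
# Crux `LatticeGapInUVUnits`, line `knabe-block-sampler`: stub S5 `stub_spectralToolkit`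

Support file for item stmt-QuantumFields-9366 (route `LangevinControlUV` of `YangMills`), registered stub
`stub_spectralToolkit` = `GapOfSquare ∧ SemigroupContraction`: two textbook spectral facts for bounded operators on a
REAL Hilbert space, for which Mathlib (v4.32.0) has no continuous functional calculus (registered for `𝕜 = ℂ` only):
(1) `0 ≤ H`, `0 < g`, `g • H ≤ H * H` (Loewner) ⇒ `g ‖x‖² ≤ ⟪H x, x⟫` on `(ker H)ᗮ`;
(2) `H` self-adjoint, `W` closed `H`-invariant, `γ‖x‖² ≤ ⟪Hx, x⟫` on `W` ⇒ `‖exp(-tH) x‖ ≤ e^{-γt}‖x‖` on `W`.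
No definitions are introduced.

Proofs (elementary, no functional calculus):
(1) from `0 ≤ ⟪H (g • y - H y), g • y - H y⟫` and `g ⟪H y, y⟫ ≤ ‖H y‖²` one gets `g ‖H y‖² ≤ ⟪H (H y), H y⟫`,
i.e. the bound on `range H`; it passes to `closure (range H) = (ker H)ᗮ` (`ContinuousLinearMap.orthogonal_ker`)
because both sides are continuous;
(2) `u s = exp (s • (-H)) x` stays in `W` (partial sums of the exponential series do, `W` is closed), has
derivative `-H (u s)` (`hasDerivAt_exp_smul_const'`), so `s ↦ e^{2γs} ‖u s‖²` has nonpositive derivative and is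
antitone (`antitone_of_hasDerivAt_nonpos`); evaluate at `0 ≤ t` and take square roots.
-/

open scoped InnerProductSpace
open Filter Topology

noncomputable section

namespace Summit.QuantumFields.YangMills.Theorems.LatticeGapInUVUnits.KnabeBlockSampler

/-- **Gap of the square** (conjunct 1 of `stub_spectralToolkit`): on a real Hilbert space, if `0 ≤ H`, `0 < g` and
`g • H ≤ H * H` in the Loewner order, then `g ‖x‖² ≤ ⟪H x, x⟫` for every `x` orthogonal to `ker H`. -/
theorem spectralToolkit_gapOfSquare (E : Type) [NormedAddCommGroup E] [InnerProductSpace ℝ E]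
    [CompleteSpace E] (H : E →L[ℝ] E) (g : ℝ) (hH : 0 ≤ H) (hg : 0 < g) (hsq : g • H ≤ H * H)
    (x : E) (hx : ∀ y : E, H y = 0 → ⟪x, y⟫_ℝ = 0) : g * ‖x‖ ^ 2 ≤ ⟪H x, x⟫_ℝ := by
  have hpos : H.IsPositive := (ContinuousLinearMap.nonneg_iff_isPositive H).mp hH
  have hsym : ∀ u v : E, ⟪H u, v⟫_ℝ = ⟪u, H v⟫_ℝ := hpos.inner_left_eq_inner_right
  have hnn : ∀ u : E, 0 ≤ ⟪H u, u⟫_ℝ := hpos.inner_nonneg_left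
  -- (i) the square inequality on the quadratic form: `g ⟪H y, y⟫ ≤ ‖H y‖²`
  have hsq' : ∀ y : E, g * ⟪H y, y⟫_ℝ ≤ ‖H y‖ ^ 2 := by
    intro y
    have h2 := ((ContinuousLinearMap.le_def _ _).mp hsq).inner_nonneg_left y
    simp only [sub_apply, mul_apply_eq_comp, smul_apply, inner_sub_left, real_inner_smul_left] at h2
    rw [hsym (H y) y, real_inner_self_eq_norm_sq] at h2
    linarith
  -- (ii) the bound on `range H`: expand `0 ≤ ⟪H (g • y - H y), g • y - H y⟫`
  have hrange : ∀ y : E, g * ‖H y‖ ^ 2 ≤ ⟪H (H y), H y⟫_ℝ := by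
    intro y
    have h3 := hnn (g • y - H y)
    have e1 : ⟪H (H y), y⟫_ℝ = ‖H y‖ ^ 2 := by rw [hsym, real_inner_self_eq_norm_sq]
    have e2 : ⟪H y, H y⟫_ℝ = ‖H y‖ ^ 2 := real_inner_self_eq_norm_sq _
    simp only [map_sub, map_smul, inner_sub_left, inner_sub_right, real_inner_smul_left,
      real_inner_smul_right, e1, e2] at h3
    have h4 := mul_le_mul_of_nonneg_left (hsq' y) hg.le
    nlinarith [h3, h4]
  -- (iii) pass to `closure (range H) ⊇ (ker H)ᗮ ∋ x`
  have hS : IsClosed {z : E | g * ‖z‖ ^ 2 ≤ ⟪H z, z⟫_ℝ} :=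
    isClosed_le (by fun_prop) (by fun_prop)
  have hsub : (H.range : Set E) ⊆ {z : E | g * ‖z‖ ^ 2 ≤ ⟪H z, z⟫_ℝ} := by
    rintro _ ⟨y, rfl⟩
    exact hrange y
  have hxmem : x ∈ closure (H.range : Set E) := by
    have h1 : x ∈ H.kerᗮ := by
      rw [Submodule.mem_orthogonal']
      intro u hu
      exact hx u (LinearMap.mem_ker.mp hu)
    rw [ContinuousLinearMap.orthogonal_ker, hpos.isSelfAdjoint.adjoint_eq] at h1
    rw [← Submodule.topologicalClosure_coe]
    exact h1
  exact closure_minimal hsub hS hxmem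

/-- **Semigroup contraction** (conjunct 2 of `stub_spectralToolkit`): if `W` is a closed `H`-invariant subspace
on which `γ ‖x‖² ≤ ⟪H x, x⟫`, then `‖exp (-(t • H)) x‖ ≤ e^{-γt} ‖x‖` for `x ∈ W` and `0 ≤ t`.  (Self-adjointness
of `H` is not needed for this half: over `ℝ`, `⟪u, H u⟫ = ⟪H u, u⟫ by symmetry of the inner product.) -/
theorem spectralToolkit_semigroupContraction (E : Type) [NormedAddCommGroup E]
    [InnerProductSpace ℝ E] [CompleteSpace E] (H : E →L[ℝ] E) (W : Submodule ℝ E) (γ : ℝ)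
    (hW : IsClosed (W : Set E)) (hHW : ∀ x ∈ W, H x ∈ W)
    (hgap : ∀ x ∈ W, γ * ‖x‖ ^ 2 ≤ ⟪H x, x⟫_ℝ) (t : ℝ) (ht : 0 ≤ t) (x : E) (hx : x ∈ W) :
    ‖NormedSpace.exp (-(t • H)) x‖ ≤ Real.exp (-(γ * t)) * ‖x‖ := by
  -- the trajectory `u s = exp (s • (-H)) x`
  set u : ℝ → E := fun s => NormedSpace.exp (s • (-H)) x with hu_def
  -- (a) the trajectory stays in the closed invariant subspace `W`
  have hmem : ∀ s : ℝ, u s ∈ W := by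
    intro s
    have hpow : ∀ n : ℕ, ((s • (-H)) ^ n) x ∈ W := by
      intro n
      induction n with
      | zero => simpa using hx
      | succ n ih =>
        rw [pow_succ', mul_apply_eq_comp, smul_apply, neg_apply]
        exact W.smul_mem _ (W.neg_mem (hHW _ ih))
    have hsum := (NormedSpace.exp_series_hasSum_exp' (𝕂 := ℝ) (s • (-H))).map
      (ContinuousLinearMap.apply ℝ E x) (ContinuousLinearMap.apply ℝ E x).continuous
    refine hW.mem_of_tendsto hsum (.of_forall fun S => ?_)
    simp only [Function.comp_apply, ContinuousLinearMap.apply_apply]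
    refine Submodule.sum_mem _ fun n _ => ?_
    rw [smul_apply]
    exact W.smul_mem _ (hpow n)
  -- (b) the trajectory is differentiable with derivative `-H (u s)`
  have hderiv : ∀ s : ℝ, HasDerivAt u (-(H (u s))) s := by
    intro s
    have h2 := (hasDerivAt_exp_smul_const' (𝕂 := ℝ) (-H) s).clm_apply (hasDerivAt_const s x)
    convert h2 using 1
    simp [hu_def]
  -- (c) the weighted squared norm `ψ s = e^{2γs} ‖u s‖²` is differentiable ...
  have hφ : ∀ s : ℝ, HasDerivAt (fun s => ‖u s‖ ^ 2) (2 * ⟪u s, -(H (u s))⟫_ℝ) s :=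
    fun s => (hderiv s).norm_sq
  have he : ∀ s : ℝ,
      HasDerivAt (fun s => Real.exp (2 * γ * s)) (Real.exp (2 * γ * s) * (2 * γ)) s := by
    intro s
    have h1 := ((hasDerivAt_id s).const_mul (2 * γ)).exp
    simpa using h1
  have hψ : ∀ s : ℝ, HasDerivAt (fun s => Real.exp (2 * γ * s) * ‖u s‖ ^ 2)
      (Real.exp (2 * γ * s) * (2 * γ) * ‖u s‖ ^ 2
        + Real.exp (2 * γ * s) * (2 * ⟪u s, -(H (u s))⟫_ℝ)) s :=
    fun s => (he s).mul (hφ s)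
  -- ... with nonpositive derivative, by the form gap on `W`
  have hψ' : ∀ s : ℝ, Real.exp (2 * γ * s) * (2 * γ) * ‖u s‖ ^ 2
      + Real.exp (2 * γ * s) * (2 * ⟪u s, -(H (u s))⟫_ℝ) ≤ 0 := by
    intro s
    have h1 := hgap (u s) (hmem s)
    have h2 : ⟪u s, -(H (u s))⟫_ℝ = -⟪H (u s), u s⟫_ℝ := by
      rw [inner_neg_right, real_inner_comm]
    rw [h2]
    have h3 := mul_le_mul_of_nonneg_left h1 (Real.exp_pos (2 * γ * s)).le
    nlinarith [h3]
  -- (d) hence it is antitone, so `e^{2γt} ‖u t‖² ≤ ‖x‖²`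
  have hanti : Antitone (fun s => Real.exp (2 * γ * s) * ‖u s‖ ^ 2) :=
    antitone_of_hasDerivAt_nonpos hψ (fun s => hψ' s)
  have hmain := hanti ht
  have h0 : Real.exp (2 * γ * 0) * ‖u 0‖ ^ 2 = ‖x‖ ^ 2 := by
    simp [hu_def]
  simp only [h0] at hmain
  -- (e) take square roots
  have hexp2 : Real.exp (2 * γ * t) = Real.exp (γ * t) ^ 2 := by
    rw [sq, ← Real.exp_add]; ring_nf
  have h5 : (Real.exp (γ * t) * ‖u t‖) ^ 2 ≤ ‖x‖ ^ 2 := by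
    rw [mul_pow, ← hexp2]; exact hmain
  have h6 : Real.exp (γ * t) * ‖u t‖ ≤ ‖x‖ :=
    (sq_le_sq₀ (by positivity) (norm_nonneg _)).mp h5
  have h7 : NormedSpace.exp (-(t • H)) x = u t := by simp [hu_def, smul_neg]
  rw [h7]
  calc ‖u t‖ = Real.exp (-(γ * t)) * (Real.exp (γ * t) * ‖u t‖) := by
        rw [← mul_assoc, ← Real.exp_add, neg_add_cancel, Real.exp_zero, one_mul]
    _ ≤ Real.exp (-(γ * t)) * ‖x‖ := mul_le_mul_of_nonneg_left h6 (Real.exp_pos _).le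

/-- **Stub S5 of line `knabe-block-sampler`** (spectral toolkit on a real Hilbert space): (1) gap of the quadratic form
on `(ker H)ᗮ` from the square inequality `g • H ≤ H * H`; (2) semigroup contraction `‖e^{-tH}x‖ ≤ e^{-γt}‖x‖` on a closed
invariant subspace carrying the form gap `γ`. -/
theorem stub_spectralToolkit : (∀ (E : Type) [NormedAddCommGroup E] [InnerProductSpace ℝ E] [CompleteSpace E] (H : E →L[ℝ] E) (g : ℝ), 0 ≤ H → 0 < g → g • H ≤ H * H → ∀ x : E, (∀ y : E, H y = 0 → ⟪x, y⟫_ℝ = 0) → g * ‖x‖ ^ 2 ≤ ⟪H x, x⟫_ℝ) ∧ (∀ (E : Type) [NormedAddCommGroup E] [InnerProductSpace ℝ E] [CompleteSpace E] (H : E →L[ℝ] E) (W : Submodule ℝ E) (γ : ℝ), IsSelfAdjoint H → IsClosed (W : Set E) → (∀ x ∈ W, H x ∈ W) → (∀ x ∈ W, γ * ‖x‖ ^ 2 ≤ ⟪H x, x⟫_ℝ) → ∀ (t : ℝ), 0 ≤ t → ∀ x ∈ W, ‖NormedSpace.exp (-(t • H)) x‖ ≤ Real.exp (-(γ * t)) *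 ‖x‖) := by
  exact ⟨fun E _ _ _ H g hH hg hsq x hx => spectralToolkit_gapOfSquare E H g hH hg hsq x hx,
    fun E _ _ _ H W γ _ hW hHW hgap t ht x hx =>
      spectralToolkit_semigroupContraction E H W γ hW hHW hgap t ht x hx⟩

end Summit.QuantumFields.YangMills.Theorems.LatticeGapInUVUnits.KnabeBlockSampler

end
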